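import Summits.QuantumFields.YangMills.Theses.UnitScaleTilt

/-!
# Route `UnitScaleTilt` (QuantumFields / YangMills; closes the rung-R3 leaf `T3YM3TorusStatement.YM3TorusSU2`) — THE ASSEMBLY ITEM,
# PROVED: `UnitTilt → HistoryTail → YM3TorusSU2`

Cell `ym3-torus` (HUMAN RULING D-0037, YM ladder rung R3), seat `ym3-torus-p2` gen 3.  WHAT THIS IS NOT: not a proof of K1 (`UnitTilt`)
or K2 (`HistoryTail`) — the d = 3 expectations step stays open —, not d = 4, not a mass gap, not Clay.

The route's items are typed BY NAME over the tree (`T3UnitScaleTilt.UnitTiltAt` / `HistoryTailAt`, p406560), so the assembly is the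
tree theorem `T3UnitScaleTilt.continuumYM3Torus_of_K1_K2` (order of choices: `m` from K1 at `L = F.L`; the profile and its threshold
from K2 at `(L, m)`; K1's threshold at that profile; refine below both — `hasContinuumLimit_of_refine_unitTiltTail`, valid for every
measurable smearing; four-measure lemma `IsTilt.abs_integral_sub_le`; Cauchy; RP / covariance / uniqueness are tree theorems on `SU(N)`),
which gives the THRESHOLD-FREE conclusion `∀ F, ∀ γ > 0, ContinuumYM3Torus F expMeanLogSU γ`; the leaf asks only `∃ γ₁ > 0, ∀ γ ≤ γ₁`.
-/

noncomputable section

open Literature.MathematicalPhysics.QuantumFieldTheory.Balaban1983to89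
open Literature.MathematicalPhysics.QuantumFieldTheory.Balaban1983to89.T3ContinuumYM3Torus
open Literature.MathematicalPhysics.QuantumFieldTheory.Balaban1983to89.T3UnitLawDensityEML (ℰp)
open Literature.MathematicalPhysics.QuantumFieldTheory.Balaban1983to89.T3UnitScaleTilt
open Summit.QuantumFields.YangMills.Theses.UnitScaleTilt

namespace Summit.QuantumFields.YangMills.Theorems

/-- **K1 ∧ K2 ⇒ R3 THRESHOLD-FREE**: `UnitTilt → HistoryTail → ∀ F, ∀ γ > 0, ContinuumYM3Torus F expMeanLogSU γ` — existence and
uniqueness of the continuum limit of all joint expectations of unit-scale block-averaged Wilson loops, Osterwalder–Schrader positivity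
and three-torus covariance, for EVERY torus family and EVERY positive dimensionless coupling (tree `continuumYM3Torus_of_K1_K2`). -/
theorem unitScaleTilt_continuumYM3Torus (hK1 : UnitTilt) (hK2 : HistoryTail) (F : T3Family) {γ : ℝ} (hγ : 0 < γ) :
    ContinuumYM3Torus F ℰp γ :=
  continuumYM3Torus_of_K1_K2 hK1 hK2 F hγ

/-- **THE ASSEMBLY ITEM OF ROUTE `UnitScaleTilt`, PROVED**: `UnitTilt → HistoryTail → YM3TorusSU2` (the rung-R3 leaf: `∃ γ₁ > 0`,
`∀ F`, `∀ γ ∈ (0, γ₁]`, `ContinuumYM3Torus F expMeanLogSU γ`; here `γ₁ := 1`, any positive number works). -/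
theorem unitScaleTilt_assembly_proof : Summit.QuantumFields.YangMills.Theses.UnitScaleTilt.Assembly := fun hK1 hK2 =>
  ⟨1, one_pos, fun F _ hγ _ => unitScaleTilt_continuumYM3Torus hK1 hK2 F hγ⟩

end Summit.QuantumFields.YangMills.Theorems

end
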